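import Summits.BirchSwinnertonDyer.BirchSwinnertonDyer.Theorems.EisensteinPrimesTwistDeformationFullAtSelmerOfFacts
import Literature.NumberTheory.IwasawaTheory.Greenberg2006.CohomologyCofiniteGenerationLeTwoOfTate
import HarnessLib

/-!
# T28 re-typing (`OfTate`) of `EisensteinPrimesTwistDeformationFullAtSelmerOfFacts.lean`

Route `EisensteinPrimes` (rung K5), crux 2 `GoodLatticeBDPValue` (stmt-BirchSwinnertonDyer-19032), line `halves`;
cell `bsd-eis`, seat `bsd-line-x1-p1` LEAD g8, lane «T28 / TATE RE-PLUMB» (helper, `--supports`).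

This file re-types, token for token, the theorems of `EisensteinPrimesTwistDeformationFullAtSelmerOfFacts` that carry
Greenberg 2006 Prop. 3.2 BY NAME (`h32 : (∀ (L : Type) [Field L] [NumberField L], Literature.NumberTheory.GaloisCohomology.tateGlobalEulerPoincareCharacteristic L)`, cofinite generation of
`Hⁱ(K_Σ/K, 𝒟)` / `Hⁱ(K_v, 𝒟)` for EVERY `i`, every number field, every prime) with that hypothesis DROPPED (only the LOCAL clause of Prop. 3.2 — cofinite generation of `Hⁱ(K_v, 𝒟)` — was read, and that clause is the unconditional tree theorem `Greenberg2006.prop32_local_holds`); elsewhere on the line the hypothesis is replaced by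
Tate's global Euler–Poincaré characteristic BY NAME for every number field
(`h32 : ∀ L, GaloisCohomology.tateGlobalEulerPoincareCharacteristic L`, Milne ADT I Thm. 5.1): on this line
Prop. 3.2 is read in degrees `i ≤ 2` only (global clause; the local clause is the unconditional
`Greenberg2006.prop32_local_holds`), and in those degrees it follows from Tate's formula alone
(`Greenberg2006.prop32_global_le_two_of_tate`, file `CohomologyCofiniteGenerationLeTwoOfTate`: `H⁰`/`H¹` of
`G_{K,S}` with finite coefficients are finite unconditionally, `H²` by Tate, and Greenberg's dévissage for `Hⁿ`
involves `Hⁿ`, `Hⁿ⁻¹` only).  Statements are otherwise VERBATIM (same binder order, new names `<name>_ofTate`);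
proofs are the tree proofs with the two reading lemmas substituted and the re-typed callees called.
EFFECT for the crux: Harari Thm. 17.13 (a) (`poitouTate_restricted_three_le`) is no longer consumed through
Prop. 3.2 at every number field, only at totally complex fields (Greenberg 2006 Prop. 4.1 is typed totally
imaginary; `cd_p ≤ 2` and the `H²` bookkeeping at the imaginary quadratic `K`), which is what the tree's
class-formation road (`RestrictedRamificationCdTwoOfH3Mu`, lane PT3-TC) proves.

Theorems only; no definition, no named fact, no `sorry`, no instance. HONEST FRAMING: conditional on the PUBLISHED
named facts carried as hypotheses; closes nothing by itself; no summit statement / BSD / the crux is proved here.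

## References
* R. Greenberg, *On the structure of certain Galois cohomology groups*, Doc. Math. Extra Vol. Coates (2006), Prop. 3.2 (p. 358). [Greenberg2006]
* J. S. Milne, *Arithmetic Duality Theorems*, 2nd ed. (2006), I Thm. 5.1 (p. 67). [MilneADT2006]
* (the references of the re-typed file apply verbatim)
-/

set_option autoImplicit false

noncomputable section

open scoped Classical
open NumberField IsDedekindDomain Field PowerSeries
open Literature.NumberTheory.EllipticCurves Literature.NumberTheory.GaloisRepresentations
  Literature.NumberTheory.IwasawaTheory Literature.NumberTheory.IwasawaTheory.Greenberg2016
  Literature.NumberTheory.IwasawaTheory.Greenberg2006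
  Summit.BirchSwinnertonDyer.BirchSwinnertonDyer.Theorems.TwistDeformationCofree

namespace Summit.BirchSwinnertonDyer.BirchSwinnertonDyer.Theorems.GreenbergFullAtSelmer

section Split

variable {K : Type} [Field K] [NumberField K] {p : ℕ} [hp : Fact p.Prime]

end Split

section H2

variable {K : Type} [Field K] [NumberField K] {S : Set (HeightOneSpectrum (𝓞 K))} {p : ℕ} [Fact p.Prime]
  {A : Type} [AddCommGroup A] [Module ℤ_[p] A] [TopologicalSpace A] [DiscreteTopology A]
  [ContinuousSMul ℤ_[p] A]
  [TopologicalSpace (PowerSeries ℤ_[p])] [TopologicalSpace (PowerSeries (PowerSeries ℤ_[p]))]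
  [IsTopologicalAddGroup (IndModule₂ ℤ_[p] p A)]
  [ContinuousSMul (PowerSeries (PowerSeries ℤ_[p])) (IndModule₂ ℤ_[p] p A)]
  (hS : ∀ v : HeightOneSpectrum (𝓞 K), ((p : ℕ) : 𝓞 K) ∈ v.asIdeal → v ∈ S)
  (κ₁ κ₂ : ZpExtension K p) (ρ₀ : ContinuousRep (GaloisGroupUnramifiedOutside K S) ℤ_[p] A)

end H2

section Consumer

variable {K : Type} [Field K] [NumberField K] {S : Set (HeightOneSpectrum (𝓞 K))} {p : ℕ} [Fact p.Prime]
  {A : Type} [AddCommGroup A] [Module ℤ_[p] A] [TopologicalSpace A] [DiscreteTopology A]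
  [ContinuousSMul ℤ_[p] A]
  [TopologicalSpace (PowerSeries ℤ_[p])] [TopologicalSpace (PowerSeries (PowerSeries ℤ_[p]))]
  [IsTopologicalRing (PowerSeries (PowerSeries ℤ_[p]))]
  [IsTopologicalAddGroup (IndModule₂ ℤ_[p] p A)]
  [ContinuousSMul (PowerSeries (PowerSeries ℤ_[p])) (IndModule₂ ℤ_[p] p A)]
  (hS : ∀ v : HeightOneSpectrum (𝓞 K), ((p : ℕ) : 𝓞 K) ∈ v.asIdeal → v ∈ S)
  (κ₁ κ₂ : ZpExtension K p) (ρ₀ : ContinuousRep (GaloisGroupUnramifiedOutside K S) ℤ_[p] A)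

/-- **[T28 `OfTate` re-typing: the hypothesis Greenberg 2006 Prop. 3.2 by name is DROPPED — only its local clause was read here, and that clause is the unconditional tree theorem `Greenberg2006.prop32_local_holds`.]** **Prop. 4.1.1 (c) AT THE INSTANCE, inputs consumed — `S_{𝓛_𝔭}(K, 𝐃)` is almost divisible for
the twist deformation `𝐃 = Ind_{K̃_∞/K}(A)` of ANY `A ≃ ℚ_p/ℤ_p` (as a `ℤ_p`-module) on which
`G_{K,S}` acts by a character, over the `ℤ_p²`-tower `K̃_∞` (cut out by a jointly surjective pair
`κ₁, κ₂`) of an IMAGINARY QUADRATIC `K` in which `p = 𝔭𝔭̄` splits**, granted: seven published facts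
(Greenberg 2016 Props. 4.1.1, 4.2.2; Greenberg 2006 Props. 3.2, 4.1, 4.2, §5 A, Thm. 3); the
vanishing `H²(K_Σ/K̃_∞, A) = 0`; and `corank_Λ S_{𝓛_𝔭}(K, 𝐃) = 0`. Relative to
`twistDeformation_fullAtSelmer_isAlmostDivisible` the following are DISCHARGED here: `hA`, `jQ`,
`hinjQ`, `hsurjQ`, `jU`, `hinjU`, `hsurjU`, `hcyc` (Prüfer/Tate duality of `ℚ_p/ℤ_p`, one
`e : A ≃ₗ[ℤ_p] ℚ_p/ℤ_p`), `hsup` (no finite prime splits completely in `K̃_∞`), `hcfg` (Prop. 3.2),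
`hK`, `hr₂`, `hdeg`, `hSp` (imaginary quadratic, `p` split), `hLEO`, `h2` (Thm. 3, degree 2).
[cite: Greenberg2016Selmer, Prop. 4.1.1 (c) (§4.1 p. 15 L21–32), §4.3 p. 20 L19–30]
[cite: Greenberg2006, Thm. 3 p. 342, Prop. 3.2 p. 358, Props. 4.1–4.2 (§4 A pp. 367–368), §5 A (p. 373)] -/
theorem twistDeformation_fullAtSelmer_isAlmostDivisible_of_linearEquiv_ofTate
    (h411 : prop411_selmer_isAlmostDivisible) (h422 : prop422_localCohomology_isAlmostDivisible)
    (h5A : sec5A_localH2_subsingleton_of_LOC1) (h41 : prop41_globalEulerPoincareCorank)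
    (h42 : prop42_localEulerPoincareCorank)
    (hthm3 : thm3_twistDeformation_cohomology_addEquiv)
    (hSf : S.Finite) (hK : IsImaginaryQuadratic K)
    (hκ : Function.Surjective fun σ : absoluteGaloisGroup K ↦ (κ₁ σ, κ₂ σ))
    (e : A ≃ₗ[ℤ_[p]] QpModZp p)
    (hscalar : ∀ g : GaloisGroupUnramifiedOutside K S, ∃ t : ℤ_[p]ˣ, ∀ a : A, ρ₀ g a = (t : ℤ_[p]) • a)
    {𝔭 𝔭bar : HeightOneSpectrum (𝓞 K)} (hne : 𝔭bar ≠ 𝔭)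
    (hp𝔭 : ((p : ℕ) : 𝓞 K) ∈ 𝔭.asIdeal) (hp𝔭bar : ((p : ℕ) : 𝓞 K) ∈ 𝔭bar.asIdeal)
    -- the named remainder
    (hH2 : Subsingleton
      ((ρ₀.restrict (galoisGroupAboveSubtype S (multiZpKer p ![κ₁, κ₂]))).H 2))
    (hSel : HasCorank (IwasawaAlgebra₂ p)
      (fullAtSpecification S (twistDeformation S hS κ₁ κ₂ ρ₀) (Sum.inr 𝔭)).selmer 0) :
    Greenberg2016.IsAlmostDivisible (IwasawaAlgebra₂ p)
      (fullAtSpecification S (twistDeformation S hS κ₁ κ₂ ρ₀) (Sum.inr 𝔭)).selmer := by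
  -- the instance data from ONE `e : A ≃ₗ[ℤ_p] ℚ_p/ℤ_p` (Prüfer brick)
  obtain ⟨hA, jQ, -, hinjQ, hsurjQ⟩ := QpModZp.exists_character_hinj_hsurj_of_linearEquiv e
  obtain ⟨jU, -, hinjU, hsurjU⟩ := QpModZp.exists_unitsCarrier_hinj_hsurj_of_linearEquiv K e
  have hcyc : ∀ (v : Place K) (σ : absoluteGaloisGroup v.Completion), ∃ u : ℤ_[p], ∀ a : A,
      DiscreteGaloisModule.units K (absGaloisRestrict K v.Completion σ) (jU a) = jU (u • a) :=
    fun v σ ↦ QpModZp.exists_units_apply_eq_smul K jU hsurjU _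
  -- the `σ`-supply (no finite prime splits completely in `K̃_∞`)
  have hsup : ∀ v : HeightOneSpectrum (𝓞 K), v ∈ S →
      ∃ σ : absoluteGaloisGroup (Place.Completion (Sum.inr v : Place K)),
        κ₁ (absGaloisRestrict K _ σ) ≠ 1 ∨ κ₂ (absGaloisRestrict K _ σ) ≠ 1 :=
    fun v _ ↦ exists_resGal_apply_ne_one_of_surjective K p hK.1.le hκ v
  -- `K` imaginary quadratic, `p` split
  haveI := hK.2
  have hKc : ∀ w : InfinitePlace K, w.IsComplex := IsTotallyComplex.isComplex
  have hr₂ := nrComplexPlaces_eq_one_of_isImaginaryQuadratic hK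
  have hdeg : 𝔭bar.asIdeal.ramificationIdx ℤ * 𝔭bar.asIdeal.inertiaDeg ℤ = 1 :=
    (ncard_primesOver_eq_two_and_deg_one_of_ne hK.1 hp𝔭 hp𝔭bar hne).2 hp𝔭bar
  have hSp : ∀ v : HeightOneSpectrum (𝓞 K), v ∈ S → ((p : ℕ) : 𝓞 K) ∈ v.asIdeal →
      v = 𝔭 ∨ v = 𝔭bar := fun v _ hv ↦ eq_or_eq_of_natCast_mem_of_ne hK.1 hp𝔭 hp𝔭bar hne hv
  -- LEO and `h₂ = 0` through Thm. 3
  obtain ⟨hLEO, h2⟩ :=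
    LEO_and_hasCorank_H2_zero_of_subsingleton_above hS κ₁ κ₂ ρ₀ hthm3 hSf hκ hA hH2
  -- cofinite generation of the local `H¹` (Prop. 3.2)
  have hcfg : ∀ v : HeightOneSpectrum (𝓞 K), v ∈ S → v ≠ 𝔭 → v ≠ 𝔭bar →
      IsCofinitelyGenerated (IwasawaAlgebra₂ p)
        ((localRep S (twistDeformation S hS κ₁ κ₂ ρ₀) (Sum.inr v)).H 1) := fun v _ _ _ ↦
    prop32_local_of_holds hSf hS (nonempty_iwasawaAlgebraTwoVar_ringEquiv_mvPowerSeries p)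
      (twistDeformation S hS κ₁ κ₂ ρ₀) Literature.NumberTheory.IwasawaTheory.Greenberg2006.IndModule₂.exists_pow_smul_eq_zero
      (isCofinitelyGenerated_indModule₂ hA jQ hinjQ hsurjQ) (Sum.inr v) 1
  exact twistDeformation_fullAtSelmer_isAlmostDivisible hS κ₁ κ₂ ρ₀ h411 h422 h5A h41 h42 hSf hKc
    hr₂ hA jQ hinjQ hsurjQ jU hinjU hsurjU hscalar hcyc hsup (hS 𝔭 hp𝔭) (hS 𝔭bar hp𝔭bar) hne
    hp𝔭bar hdeg hSp hLEO h2 hSel hcfg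

end Consumer

end Summit.BirchSwinnertonDyer.BirchSwinnertonDyer.Theorems.GreenbergFullAtSelmer

end
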